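import Summits.BirchSwinnertonDyer.Rank1Residual.Additive.RamifiedSevenGenusKummerColumn
import HarnessLib

/-!
# `𝒞₇` genus road (crux `EllipticUnitValueSevenOfGZK`, K7r), row K2C-12 — the G-ADDENDUM (H_e):
# the Kummer column on a `γ₂ ∈ T₇W₂_K` whose reduction mod 7 is NOT killed by `φ ∘ α`

Cell bsd-cm, seat bsd-cm-k-ty1 g31 (literature-prover).  Text of record: pen D1069 (F2) / D1073 (P5)(1): the column of
`KummerColumn.exists_kummerColumn` (p810836) only records `γ₂ ≠ 0`, which is INSUFFICIENT for (B2′) — if `γ₂ ∈ π₂·T₇W₂_K`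
every mod-7 layer class `κ ∪ g₁(α e₁)` vanishes (memo `Cruxes/EllipticUnitValueSevenOfGZK/K2C12KummerNonvanishing_g31.md` §0 F2).
This file supplies the column with the GOOD normalisation (H_e) `φ (α (e₁)) ≠ 0`, `e₁ := (ofTorsionTower … γ₂).e 1 = γ₂ mod 7`,
for the CM endomorphism `φ` of `W_K` (`φ ∘ φ = [−7]`):

* §1 `exists_geomTorsion_seven_apply_ne_zero` — `φ` does not kill `W_K[7]` (a point `R` of exact order 49: if `φ(W[7]) = 0` then
  `φ R ∈ W[7]`, so `−7R = φ(φ R) = 0`); `exists_geomTorsion_seven_comp_apply_ne_zero` — some `P ∈ W₂_K[7]` has `φ(α P) ≠ 0`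
  (`P := β Q`: `α (β Q) = e • Q` from `β ∘ α = [e]` and the surjectivity of `α`, and `e ∈ {1, 2}` is prime to 7);
* §2 `exists_tateModule_good` — a `γ₂ ∈ T₇W₂_K` with `φ (α (γ₂ mod 7)) ≠ 0` (`T₇W₂_K ↠ W₂_K[7]`, the tree's
  `TateModule.proj_surjective_of_card` with `#W₂[7ⁿ] = 7²ⁿ`, `card_torsionPoints_eq_sq_holds`);
* §3 ★ `exists_kummerColumn_of_good_gamma` — `exists_kummerColumn` with the conjunct `γ₂ ≠ 0` STRENGTHENED to (H_e), for a given
  `φ` (displayed binders `(φ) (hφ)`), via `KummerColumn.exists_kummerColumn_of_gamma`.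

HONEST LABEL: theorems only (no definition, no named fact, no instance, no `sorry`); conditional on the displayed named facts of G
(`h159′, hE, h25, h24i, hM1, hM1′, hG`); nothing closes; (B2′) NOT proved; stmt-BirchSwinnertonDyer-19945 OPEN; no summit statement is
proved by this seat; BSD is claimed for no curve.

## References
* K. Kato, Astérisque 295 (2004), §15.5 (p. 253), (15.12.1) (p. 263), 15.14 (p. 264). [Kato2004Asterisque]
* J. H. Silverman, *The Arithmetic of Elliptic Curves* (2009), Cor. III.6.4 (b), Prop. III.7.1 (a), Thm. III.6.2. [SilvermanAEC2009]
* Tree: `Additive/RamifiedSevenGenusKummerColumn.lean` (`exists_kummerColumn_of_gamma`, `exists_partner_isogenyPair` via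
  `EllipticUnitColumn`), `Kato2004/KummerFrameOfTorsionTower.lean` (`exists_geomPoint_exactOrder`, `ofTorsionTower_e`),
  `Kato2004/IwasawaH1ReductionPkNumberField.lean` (`tateModPkK`), `EllipticCurves/TateModuleRank.lean` (`proj_surjective_of_card`).
-/

noncomputable section

open scoped NumberField TensorProduct
open WeierstrassCurve Field NumberField IsDedekindDomain
open Literature.NumberTheory.GaloisRepresentations
open Literature.NumberTheory.EllipticCurves
open Literature.NumberTheory.EllipticCurves.Rank1Residual
open Literature.NumberTheory.EllipticCurves.Kato2004
open Literature.NumberTheory.ComplexMultiplication.EllipticUnits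
open Summit.BirchSwinnertonDyer.Rank1Residual
open Summit.BirchSwinnertonDyer.Rank1Residual.Additive.GenusSeven.EllipticUnitColumn

namespace Summit.BirchSwinnertonDyer.Rank1Residual.Additive.GenusSeven.KummerColumnGoodGamma

/-! ## §1 `φ` does not kill `W[7]`; some `P ∈ W₂[7]` has `φ(α P) ≠ 0` -/

section Torsion

variable {L : Type} [Field L] [NumberField L] {V V₂ : WeierstrassCurve L} [V.IsElliptic] [V₂.IsElliptic]

/-- **`φ(W[7]) ≠ 0` for `φ ∘ φ = [−7]`**: take `R` of exact order `49` (`exists_geomPoint_exactOrder`); if `φ` killed `W[7]` then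
`7 • φ R = φ (7 • R) = 0`, so `φ R ∈ W[7]` and `−7 • R = φ (φ R) = 0`, contradicting the order of `R`.
[cite: SilvermanAEC2009, Cor. III.6.4 (b)] -/
theorem exists_geomTorsion_seven_apply_ne_zero (φ : Isogeny V V) (hφ : ∀ P, φ (φ P) = (-7 : ℤ) • P) :
    ∃ Q : geomPoints V, (7 : ℤ) • Q = 0 ∧ φ Q ≠ 0 := by
  haveI : Fact (Nat.Prime 7) := ⟨by norm_num⟩
  obtain ⟨R, hR49, hRord⟩ := exists_geomPoint_exactOrder V 7 2 (by norm_num)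
  by_contra hall
  push Not at hall
  have h7R : (7 : ℤ) • ((7 : ℤ) • R) = 0 := by
    rw [← mul_zsmul]
    exact_mod_cast hR49
  have hφR7 : (7 : ℤ) • φ R = 0 := by
    rw [← map_zsmul]
    exact hall _ h7R
  have hφφR : φ (φ R) = 0 := hall _ hφR7
  rw [hφ] at hφφR
  have h7 : (7 : ℤ) • R = 0 := by
    have := congrArg (fun P ↦ (-1 : ℤ) • P) hφφR
    simpa [← mul_zsmul] using this
  exact hRord 7 (by norm_num) (by norm_num) (by exact_mod_cast h7)

/-- **Some `P ∈ W₂[7]` has `φ (α P) ≠ 0`** when `β ∘ α = [e]` with `e ∈ {1,2}`: `P := β Q` for `Q ∈ W[7]` with `φ Q ≠ 0`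
(`α (β Q) = e • Q` as `α` is onto, and `e • φ Q ≠ 0` since `7 • φ Q = 0`, `φ Q ≠ 0`, `gcd(e,7) = 1`).
[cite: SilvermanAEC2009, Thm. III.6.2 and Cor. III.6.4 (b)] -/
theorem exists_geomTorsion_seven_comp_apply_ne_zero (α : Isogeny V₂ V) (β : Isogeny V V₂) {e : ℤ}
    (hβα : ∀ P, β (α P) = e • P) (he : e = 1 ∨ e = 2) (φ : Isogeny V V) (hφ : ∀ P, φ (φ P) = (-7 : ℤ) • P) :
    ∃ P : geomPoints V₂, (7 : ℤ) • P = 0 ∧ φ (α P) ≠ 0 := by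
  obtain ⟨Q, hQ7, hQ⟩ := exists_geomTorsion_seven_apply_ne_zero φ hφ
  have hαβ : α (β Q) = e • Q := by
    obtain ⟨P, rfl⟩ := α.surjective Q
    rw [hβα, map_zsmul]
  refine ⟨β Q, by rw [← map_zsmul, hQ7, map_zero], ?_⟩
  rw [hαβ, map_zsmul]
  intro h0
  apply hQ
  have h7 : (7 : ℤ) • φ Q = 0 := by rw [← map_zsmul, hQ7, map_zero]
  rcases he with rfl | rfl
  · simpa using h0
  · -- `2 • φQ = 0` and `7 • φQ = 0` ⇒ `φQ = 7 • φQ - 3 • (2 • φQ) = 0`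
    have : φ Q = (7 : ℤ) • φ Q - (3 : ℤ) • ((2 : ℤ) • φ Q) := by module
    rw [this, h7, h0, smul_zero, sub_zero]

end Torsion

/-! ## §2 A good `γ₂ ∈ T₇W₂_K` -/

section Good

variable {L : Type} [Field L] [NumberField L] {V V₂ : WeierstrassCurve L} [V.IsElliptic] [V₂.IsElliptic]

/-- **`T₇V₂ ↠ V₂[7]` hits a point not killed by `φ ∘ α`**: there is `γ₂ ∈ T₇V₂` with `φ (α (γ₂ mod 7)) ≠ 0`
(`TateModule.proj_surjective_of_card` with `#V₂[7ⁿ] = 7²ⁿ`). [cite: SilvermanAEC2009, Prop. III.7.1 (a) and Cor. III.6.4 (b)] -/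
theorem exists_tateModule_good (α : Isogeny V₂ V) (β : Isogeny V V₂) {e : ℤ} (hβα : ∀ P, β (α P) = e • P)
    (he : e = 1 ∨ e = 2) (φ : Isogeny V V) (hφ : ∀ P, φ (φ P) = (-7 : ℤ) • P) :
    ∃ γ₂ : V₂.tateModule 7,
      φ (α ((tateModPkK V₂ 7 1 γ₂ : geomTorsion V₂ ((7 : ℤ) ^ 1)) : geomPoints V₂)) ≠ 0 := by
  haveI : Fact (Nat.Prime 7) := ⟨by norm_num⟩
  obtain ⟨P, hP7, hP⟩ := exists_geomTorsion_seven_comp_apply_ne_zero α β hβα he φ hφ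
  have hcard : ∀ n : ℕ, Nat.card (geomTorsion V₂ ((7 ^ n : ℕ) : ℤ)) = 7 ^ (2 * n) := fun n ↦ by
    rw [mul_comm, pow_mul]
    exact WeierstrassCurve.card_torsionPoints_eq_sq_holds V₂ (AlgebraicClosure L) (n := 7 ^ n)
      (by exact_mod_cast pow_ne_zero n (by norm_num : (7 : ℕ) ≠ 0))
  have hPmem : P ∈ geomTorsion V₂ ((7 ^ 1 : ℕ) : ℤ) :=
    (Submodule.mem_torsionBy_iff (R := ℤ) _ _).mpr (by simpa using hP7)
  obtain ⟨γ₂, hγ₂⟩ := TateModule.proj_surjective_of_card (A := geomPoints V₂) (p := 7) (d := 2) hcard 1 hPmem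
  refine ⟨γ₂, ?_⟩
  rw [coe_tateModPkK_apply, hγ₂]
  exact hP

end Good

/-! ## §3 The Kummer column with the good `γ₂` -/

/-- ★ **THE KUMMER COLUMN WITH (H_e)** — `KummerColumn.exists_kummerColumn` (p810836) with its conjunct `γ₂ ≠ 0` STRENGTHENED to
`φ (α (e₁)) ≠ 0`, `e₁ = (ofTorsionTower W₂_K 7 (7d) hf γ₂).e 1 = γ₂ mod 7`, for a given CM endomorphism `φ` of `W_K` with
`φ ∘ φ = [−7]` (displayed binders `φ`, `hφ`): the normalisation row K2C-12 ((B2′), `EU_not_mem_of_residue`) needs — without it every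
mod-7 layer class `κ ∪ g₁(α e₁)` of the column vanishes.  Proof: `exists_partner_isogenyPair`, `exists_tateModule_good`,
`exists_ofTorsionTower_e_ne_zero`'s role played by `e 1 ≠ 0` (from `φ(α(e 1)) ≠ 0`), then `exists_kummerColumn_of_gamma`.
Conditional on `h159′, hE, h25, h24i, hM1, hM1′, hG`; `ιC := algClosureEmb ι₀`.
[cite: Kato2004Asterisque, (15.6.1) (p. 253), (15.12.1) (p. 263), 15.14 (p. 264), Prop. 15.9 and (15.9.1) (pp. 258–259)]
[cite: SilvermanAEC2009, Prop. III.7.1 (a), Thm. III.6.2] -/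
theorem exists_kummerColumn_of_good_gamma (h159' : CM.prop159_kummerCup_expStar_values)
    (hE : Literature.NumberTheory.ComplexMultiplication.EllipticUnits.Kato2004.sec155_exists_katoUnitRep)
    (h25 : DeShalit1987.prop25_i_normRelation) (h24i : DeShalit1987.prop24_i_mem_rayClassField)
    (hM1 : CM.rayClassField_le_torsionField) (hM1' : CM.torsionField_le_rayClassField_of_conductor)
    (hG : Gross_conductorExponent_baseChange_eq_two_mul)
    {W : WeierstrassCurve ℚ} [W.IsElliptic] [W.IsGloballyMinimal] [Fact (Nat.Prime 7)] (hC : X12.ClassCSeven W) {d : ℕ}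
    (hbad : ∀ (q : ℕ) [Fact q.Prime], q ≠ 7 → (¬ Good W q ↔ q ∣ d)) (hodd : Odd d)
    (Kcm : Type) [Field Kcm] [NumberField Kcm] (h2 : Module.finrank ℚ Kcm = 2) (s : Kcm) (hs : s ^ 2 = -7)
    (c : Kcm ≃ₐ[ℚ] Kcm) (hc : c ≠ 1) (ι₀ : Kcm →+* ℂ) (hι₀ : ∀ (w : InfinitePlace Kcm) (x : Kcm), ι₀ x = w.embedding x)
    [ContinuousSMul ℤ_[7] ((W.baseChange Kcm).tateModule 7)]
    (K : ZpExtension ℚ 7) (hK : K.IsCyclotomic) {γK : absoluteGaloisGroup Kcm}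
    (IK : IwasawaH1DataOver (W.baseChange Kcm) 7 (K.restrictOfFinrankEqTwo (by decide) Kcm h2) γK)
    (𝔣 : Ideal (𝓞 Kcm)) (h𝔣N : Ideal.absNorm 𝔣 = 7 * d ^ 2) (h𝔣dvd : 𝔣 ∣ Ideal.span {((7 * d : ℕ) : 𝓞 Kcm)})
    (φ : Isogeny (W.baseChange Kcm) (W.baseChange Kcm)) (hφ : ∀ P, φ (φ P) = (-7 : ℤ) • P) :
    ∃ (W₂ : WeierstrassCurve ℚ) (_ : W₂.IsElliptic) (_ : W₂.IsGloballyMinimal)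
      (_ : ContinuousSMul ℤ_[7] ((W₂.baseChange Kcm).tateModule 7))
      (α : Isogeny (W₂.baseChange Kcm) (W.baseChange Kcm)) (β : Isogeny (W.baseChange Kcm) (W₂.baseChange Kcm)) (e : ℤ)
      (γ₂ : (W₂.baseChange Kcm).tateModule 7) (hf : 0 < 7 * d)
      (ψ : HeckeCharacter Kcm) (Ω : ℂ)
      (𝔏 : ∀ U : Subgroup (absoluteGaloisGroup Kcm),
        H1 (CM.tateRepK (W.baseChange Kcm) 7) U →ₗ[ℤ_[7]] ℚ_[7] ⊗[ℤ] AlgebraicClosure Kcm)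
      (euK : Ideal (𝓞 Kcm) → IK.H),
      W₂.j = -3375 ∧ (∀ P, β (α P) = e • P) ∧ (e = 1 ∨ e = 2) ∧
      φ (α (((KummerFrame.ofTorsionTower (W₂.baseChange Kcm) 7 (7 * d) hf γ₂).e 1 :
        geomTorsion (W₂.baseChange Kcm) ((7 : ℤ) ^ 1)) : geomPoints (W₂.baseChange Kcm))) ≠ 0 ∧
      ψ.HasInfinityType (fun _ ↦ 1) (fun _ ↦ 0) ∧
      (∀ z : ℂ, 3 / 2 < z.re → heckeLFunction ψ z = W.LSeries z) ∧
      (∀ a : 𝓞 Kcm, a ≠ 0 → ((7 * d : ℕ) : 𝓞 Kcm) ∣ a - 1 →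
        CM.heckeCharIdealValue ψ (Ideal.span {a}) = algClosureEmb ι₀ (algebraMap Kcm (AlgebraicClosure Kcm) (a : Kcm))) ∧
      Ω ≠ 0 ∧
      ∀ 𝔟 : Ideal (𝓞 Kcm), IsTwist 7 𝔣 𝔟 →
        ∃ u : (KummerFrame.ofTorsionTower (W₂.baseChange Kcm) 7 (7 * d) hf γ₂).UnitTower,
          (∀ n : ℕ, 1 ≤ n → CM.IsKatoUnitRepAt 7 (algClosureEmb ι₀) (Ideal.span {((7 * d : ℕ) : 𝓞 Kcm)}) n 𝔟 (u.z n)) ∧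
          (∃ y : Subgroup (absoluteGaloisGroup Kcm) → AlgebraicClosure Kcm,
            CM.EllipticZetaBody Kcm (W.baseChange Kcm) 7 ψ (7 * d) (algClosureEmb ι₀) Ω 𝔏 𝔟
              (fun U ↦ isogenyLayerMapK 7 α U ((KummerFrame.ofTorsionTower (W₂.baseChange Kcm) 7 (7 * d) hf γ₂).tateClass u U)) y) ∧
          ∀ n : ℕ, IK.proj n (euK 𝔟) = isogenyLayerMapK 7 α _
            ((KummerFrame.ofTorsionTower (W₂.baseChange Kcm) 7 (7 * d) hf γ₂).tateClass u
              ((K.restrictOfFinrankEqTwo (by decide) Kcm h2).layerSubgroup n)) := by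
  -- the maximal-order partner and the isogeny pair over `Kcm`
  obtain ⟨W₂, hW₂, hmin, α, β, e, hjW₂, hiso, hβα, he⟩ := exists_partner_isogenyPair hC.2.1 Kcm
  haveI := hW₂
  haveI := hmin
  haveI : ContinuousSMul ℤ_[7] ((W₂.baseChange Kcm).tateModule 7) := TateModule.continuousSMul_padicInt
  have hf : 0 < 7 * d := by
    have hd0 : d ≠ 0 := by
      rintro rfl
      exact (Nat.not_odd_iff_even.mpr (by decide)) hodd
    omega
  -- a GOOD `γ₂`: `φ (α (γ₂ mod 7)) ≠ 0`
  obtain ⟨γ₂, hγ₂⟩ := exists_tateModule_good α β hβα he φ hφ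
  have he₁ : φ (α (((KummerFrame.ofTorsionTower (W₂.baseChange Kcm) 7 (7 * d) hf γ₂).e 1 :
      geomTorsion (W₂.baseChange Kcm) ((7 : ℤ) ^ 1)) : geomPoints (W₂.baseChange Kcm))) ≠ 0 := by
    rw [KummerFrame.ofTorsionTower_e]
    exact hγ₂
  have he₂ : ∃ k, (KummerFrame.ofTorsionTower (W₂.baseChange Kcm) 7 (7 * d) hf γ₂).e k ≠ 0 := by
    refine ⟨1, fun h0 ↦ he₁ ?_⟩
    rw [h0, ZeroMemClass.coe_zero, map_zero, map_zero]
  obtain ⟨ψ, Ω, 𝔏, euK, hψ, hLW, hψf, hΩ, hcol⟩ := KummerColumn.exists_kummerColumn_of_gamma h159' hE h25 h24i hM1 hM1' hG hC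
    hbad hodd Kcm h2 s hs c hc ι₀ hι₀ K hK IK 𝔣 h𝔣N h𝔣dvd hjW₂ hiso α β e hβα he γ₂ hf he₂
  exact ⟨W₂, hW₂, hmin, inferInstance, α, β, e, γ₂, hf, ψ, Ω, 𝔏, euK, hjW₂, hβα, he, he₁, hψ, hLW, hψf, hΩ, hcol⟩

end Summit.BirchSwinnertonDyer.Rank1Residual.Additive.GenusSeven.KummerColumnGoodGamma

end
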